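import Summits.KontsevichZagierPeriods.KontsevichZagierPeriods.Theorems.FurushoPentagonHoffmanRelationInKZCubicalTransportAux2

/-!
# `HoffmanRelationInKZ`, line `dilation-homotopy-transposition`: stub `stub_cubicalTransport`

Stub `stub_cubicalTransport` of the crux `HoffmanRelationInKZ` (stmt-KontsevichZagierPeriods-3930,
route FurushoPentagon). For a non-empty admissible index `s` of weight `n` and the cubical
integrand `f_s(x) = ∏_{l<k} T_{p_l}(x)/(1 − T_{p_{l+1}}(x))` (`T_m = x₀⋯x_{m-1}`,
`p_l = s₁+⋯+s_l`), the cubical chart `tᵢ = x₀⋯xᵢ` of the ordered simplex is ONE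
`KZ.changeOfVariablesRel` move (polynomial, injective on the open cube, image the open simplex,
lower-triangular Jacobian `∏ᵢ Tᵢ(x) > 0`) carrying Kontsevich's simplex integrand of `ζ(s)` to
`f_s` (`stub_cubicalPullback`): this gives (1) the existence of the cubical representation
`[(0,1)ⁿ, f_s]` (absolute integrability transported from `KZ.mzvIntegrand_integrableOn_holds`),
(2) its KZ-equivalence with `KZ.mzvRep s`, (3) the same with a spectator coordinate `u` and the
factor `1/(1−u)` (shuffle side `[{u < x₀}, f_s(x)/(1−u)]` versus its simplicial form
`[{t ∈ Δⁿ, 0 < u < t₀}, ∏ω_{εᵢ}(tᵢ)/(1−u)]`), and (4) existence transfer back along the chart.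
All four are instances of `monomialChart_transport`.

References: M. Kontsevich, D. Zagier, *Periods* (2001), §1.2 rule (2); D. Zagier, *Values of zeta
functions and their applications* (1994), §9.
-/

noncomputable section

open Set MeasureTheory MvPolynomial
open Literature.NumberTheory.Transcendental
open Literature.ModelTheory.ExponentialFields (IsSemialgebraic)

namespace Summit.KontsevichZagierPeriods.FurushoPentagon.HoffmanRelationInKZ

/-! ### Semialgebraic domains -/

/-- The open unit cube `(0,1)ⁿ` is `ℚ`-semialgebraic. [folklore] -/
private theorem isSemialgebraic_openCube (n : ℕ) :
    IsSemialgebraic ℚ {x : Fin n → ℝ | ∀ i, x i ∈ Ioo (0 : ℝ) 1} := by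
  have : {x : Fin n → ℝ | ∀ i, x i ∈ Ioo (0 : ℝ) 1} = ⋂ i ∈ (Finset.univ : Finset (Fin n)),
      ({x | 0 < aeval x (X i : MvPolynomial (Fin n) ℚ)} ∩
        {x | 0 < aeval x (1 - X i : MvPolynomial (Fin n) ℚ)}) := by
    ext x
    simp [sub_pos]
  rw [this]
  exact IsSemialgebraic.biInter _ _ fun i _ =>
    (Literature.ModelTheory.ExponentialFields.isSemialgebraic_setOf_eval_pos _).inter
      (Literature.ModelTheory.ExponentialFields.isSemialgebraic_setOf_eval_pos _)

/-- The cubical shuffle-side domain `{y ∈ (0,1)ⁿ⁺¹ | y₀ < y₁}` is `ℚ`-semialgebraic. [folklore] -/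
private theorem isSemialgebraic_cubicalShuffleDomain (n : ℕ) :
    IsSemialgebraic ℚ {y : Fin (n + 1) → ℝ | (∀ i, y i ∈ Ioo (0 : ℝ) 1) ∧ y 0 < y 1} := by
  have : {y : Fin (n + 1) → ℝ | (∀ i, y i ∈ Ioo (0 : ℝ) 1) ∧ y 0 < y 1} =
      {y : Fin (n + 1) → ℝ | ∀ i, y i ∈ Ioo (0 : ℝ) 1} ∩
        {y | 0 < aeval y (X 1 - X 0 : MvPolynomial (Fin (n + 1)) ℚ)} := by
    ext y
    simp [sub_pos]
  rw [this]
  exact (isSemialgebraic_openCube (n + 1)).inter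
    (Literature.ModelTheory.ExponentialFields.isSemialgebraic_setOf_eval_pos _)

/-! ### The stub -/

/-- **Cubical transport** (stub `stub_cubicalTransport` of the line
`dilation-homotopy-transposition`). For a non-empty admissible `s` of weight `n`, with `f` the
cubical integrand `∏_l T_{p_l}/(1 − T_{p_{l+1}})`: (1) the cubical representation `[(0,1)ⁿ, f]`
exists; (2) every representation of that shape is KZ-equivalent to `KZ.mzvRep s` by ONE change of
variables along the cubical chart `tᵢ = x₀⋯xᵢ` (polynomial, injective on the open cube, image the
open simplex, triangular Jacobian `∏ᵢ Tᵢ(x) > 0`, pull-back identity `stub_cubicalPullback`);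
(3) the same chart with the spectator `u` moves the shuffle side `[{u < x₀}, f(x)/(1−u)]` onto its
simplicial form `[{t ∈ Δⁿ, 0 < u < t₀}, ∏ ω_{εᵢ}(tᵢ)/(1−u)]`; (4) existence transfers back along
it. [cite: KontsevichZagier2001, §1.2 rule (2)] -/
theorem stub_cubicalTransport : ∀ (s : List ℕ) (hs : MZV.IsAdmissible s), s ≠ [] → ∀ (f : (Fin (MZV.weight s) → ℝ) → ℝ), (∀ x, f x = ∏ l : Fin s.length, (∏ j : Fin (MZV.weight s), if (j : ℕ) < (s.take l).sum then x j else 1) / (1 - (∏ j : Fin (MZV.weight s), if (j : ℕ) < (s.take ((l : ℕ) + 1)).sum then x j else 1))) → (∃ r : KZ.IntegralRep (MZV.weight s), (r.domain = {x : Fin (MZV.weight s) → ℝ | ∀ i, x i ∈ Set.Ioo (0:ℝ) 1} ∧ Set.EqOn r.integrand f r.domain)) ∧ (∀ r : KZ.IntegralRep (MZV.weight s), (r.domain = {x : Fin (MZV.weight s) → ℝ | ∀ i, x i ∈ Set.Ioo (0:ℝ) 1} ∧ Set.EqOn r.integrand f r.domain) → KZ.Equivalent r (KZ.mzvRep s hs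 (KZ.mzvIntegrand_isSemialgebraicFunOn_holds s) (KZ.mzvIntegrand_integrableOn_holds s hs))) ∧ (∀ r r' : KZ.IntegralRep (MZV.weight s + 1), (r.domain = {y : Fin (MZV.weight s + 1) → ℝ | (∀ i, y i ∈ Set.Ioo (0:ℝ) 1) ∧ y 0 < y 1} ∧ Set.EqOn r.integrand (fun y => f (Fin.tail y) / (1 - y 0)) r.domain) → (r'.domain = {y : Fin (MZV.weight s + 1) → ℝ | Fin.tail y ∈ KZ.openOrderedSimplex (MZV.weight s) ∧ 0 < y 0 ∧ y 0 < y 1} ∧ Set.EqOn r'.integrand (fun y => KZ.mzvIntegrand s (Fin.tail y) / (1 - y 0)) r'.domain) → KZ.Equivalent r r') ∧ ((∃ r' : KZ.IntegralRep (MZV.weight s + 1), (r'.domain = {y : Fin (MZV.weight s + 1) → ℝ | Fin.tail y ∈ KZ.openOrderedSimplex (MZV.weight s) ∧ 0 < y 0 ∧ y 0 < y 1} ∧ Set.EqOn r'.integrand (fun y => KZ.mzvIntegrand s (Fin.tail y) / (1 - y 0)) r'.domain)) → ∃ r : KZ.IntegralRep (MZV.weight s + 1), (r.domain = {y : Fin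 (MZV.weight s + 1) → ℝ | (∀ i, y i ∈ Set.Ioo (0:ℝ) 1) ∧ y 0 < y 1} ∧ Set.EqOn r.integrand (fun y => f (Fin.tail y) / (1 - y 0)) r.domain)) := by
  intro s hs hne f hf
  have hn : 0 < MZV.weight s := by
    obtain ⟨a, t, rfl⟩ := List.exists_cons_of_ne_nil hne
    have ha : 2 ≤ a := hs.2 (List.cons_ne_nil a t)
    simp only [MZV.weight, List.sum_cons]
    omega
  -- the partial products `T`, the cubical chart `Φ`, the spectator chart `Ψ`
  obtain ⟨T, hT⟩ : ∃ T : ℕ → (Fin (MZV.weight s) → ℝ) → ℝ,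
      ∀ m x, T m x = ∏ j : Fin (MZV.weight s), if (j : ℕ) < m then x j else 1 := ⟨_, fun _ _ => rfl⟩
  obtain ⟨Φ, hΦ⟩ : ∃ Φ : (Fin (MZV.weight s) → ℝ) → (Fin (MZV.weight s) → ℝ), ∀ x i, Φ x i =
      ∏ j ∈ Finset.univ.filter (fun j : Fin (MZV.weight s) => (j : ℕ) < (i : ℕ) + 1), x j :=
    ⟨_, fun _ _ => rfl⟩
  obtain ⟨Ψ, hΨ⟩ : ∃ Ψ : (Fin (MZV.weight s + 1) → ℝ) → (Fin (MZV.weight s + 1) → ℝ), ∀ y i,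
      Ψ y i = ∏ j ∈ Finset.univ.filter (fun j : Fin (MZV.weight s + 1) =>
        (j : ℕ) < (i : ℕ) + 1 ∧ ((i : ℕ) = 0 ∨ 0 < (j : ℕ))), y j := ⟨_, fun _ _ => rfl⟩
  obtain ⟨hS, hS'⟩ := cubicalChart_rows (MZV.weight s)
  obtain ⟨hR, hR'⟩ := spectatorChart_rows (MZV.weight s)
  have hcube := isSemialgebraic_openCube (MZV.weight s)
  have hA := isSemialgebraic_cubicalShuffleDomain (MZV.weight s)
  have himg := image_cubicalChart T hT Φ hΦ
  have himg' := stub_spectatorChartImage (MZV.weight s) hn T hT Φ hΦ Ψ hΨ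
  -- the pull-back identity on the cube, in both charts
  have hpull : ∀ x ∈ {x : Fin (MZV.weight s) → ℝ | ∀ i, x i ∈ Ioo (0 : ℝ) 1},
      f x = KZ.mzvIntegrand s (Φ x) * ∏ i : Fin (MZV.weight s), T i x := by
    intro x hx
    have hΦx : Φ x = fun i : Fin (MZV.weight s) => T ((i : ℕ) + 1) x :=
      funext fun i => cubicalChart_apply T hT Φ hΦ x i
    rw [hΦx, stub_cubicalPullback s hs.1 T hT x (fun i => (hx i).1.ne'), hf]
    simp only [hT]
  have hJpos : ∀ x ∈ {x : Fin (MZV.weight s) → ℝ | ∀ i, x i ∈ Ioo (0 : ℝ) 1},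
      0 < ∏ i : Fin (MZV.weight s), T i x :=
    fun x hx => Finset.prod_pos fun i _ => (partialProd_pos_le T hT hx i).1
  have hpullΦ : ∀ x ∈ {x : Fin (MZV.weight s) → ℝ | ∀ i, x i ∈ Ioo (0 : ℝ) 1},
      f x = KZ.mzvIntegrand s (Φ x) * |∏ i : Fin (MZV.weight s), ∏ k ∈ (Finset.univ.filter
        (fun j : Fin (MZV.weight s) => (j : ℕ) < (i : ℕ) + 1)).erase i, x k| := by
    intro x hx
    rw [Finset.prod_congr rfl fun i _ => cubicalChart_diag T hT x i, abs_of_pos (hJpos x hx)]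
    exact hpull x hx
  have hpullΨ : ∀ y ∈ {y : Fin (MZV.weight s + 1) → ℝ | (∀ i, y i ∈ Ioo (0 : ℝ) 1) ∧ y 0 < y 1},
      f (Fin.tail y) / (1 - y 0) = KZ.mzvIntegrand s (Fin.tail (Ψ y)) / (1 - Ψ y 0) *
        |∏ i : Fin (MZV.weight s + 1), ∏ k ∈ (Finset.univ.filter (fun j : Fin (MZV.weight s + 1) =>
          (j : ℕ) < (i : ℕ) + 1 ∧ ((i : ℕ) = 0 ∨ 0 < (j : ℕ)))).erase i, y k| := by
    rintro y ⟨hy, -⟩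
    have hty : Fin.tail y ∈ {x : Fin (MZV.weight s) → ℝ | ∀ i, x i ∈ Ioo (0 : ℝ) 1} :=
      fun i => hy i.succ
    rw [spectatorChart_diag T hT, spectatorChart_zero Ψ hΨ, spectatorChart_tail T hT Φ hΦ Ψ hΨ,
      abs_of_pos (hJpos _ hty), hpull _ hty]
    ring
  obtain ⟨hex, hmove⟩ := monomialChart_transport _ hS hS' hcube Φ hΦ
    (injOn_cubicalChart T hT Φ hΦ) f (KZ.mzvIntegrand s) hpullΦ
  obtain ⟨hex', hmove'⟩ := monomialChart_transport _ hR hR' hA Ψ hΨ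
    (injOn_spectatorChart T hT Φ hΦ Ψ hΨ) (fun y => f (Fin.tail y) / (1 - y 0))
    (fun y => KZ.mzvIntegrand s (Fin.tail y) / (1 - y 0)) hpullΨ
  refine ⟨?_, ?_, ?_, ?_⟩
  · obtain ⟨r, hr, hri⟩ := hex (KZ.mzvRep s hs (KZ.mzvIntegrand_isSemialgebraicFunOn_holds s)
      (KZ.mzvIntegrand_integrableOn_holds s hs)) (by rw [KZ.mzvRep_domain, himg]) (fun _ _ => rfl)
    exact ⟨r, hr, fun x _ => by rw [hri]⟩
  · rintro r ⟨hdom, hint⟩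
    exact hmove r _ hdom (by rw [← hdom]; exact hint) (by rw [KZ.mzvRep_domain, himg])
      (fun _ _ => rfl)
  · rintro r r' ⟨hdom, hint⟩ ⟨hdom', hint'⟩
    exact hmove' r r' hdom (by rw [← hdom]; exact hint) (by rw [hdom', himg']) hint'
  · rintro ⟨r', hdom', hint'⟩
    obtain ⟨r, hr, hri⟩ := hex' r' (by rw [hdom', himg']) hint'
    exact ⟨r, hr, fun y _ => by rw [hri]⟩

end Summit.KontsevichZagierPeriods.FurushoPentagon.HoffmanRelationInKZ
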